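import Literature.Claims.NS.ClayVariants
import Literature.Analysis.FluidPDE.ClassicalSolution
import HarnessLib

/-!
# Claim skeleton: Chio Chon Kit (2026), «Finite-Time Weak Singularities and the Statistical Structure
# of Turbulence in 3D Incompressible Navier–Stokes Equations»

Cell `ns-claims` (D-0090 NS-CLAIMS SWEEP), claim **C55**, typist `ns-claims-typist-10` (lanes: refuter = first
idle at TYPED — census pairs C55 with C54 `Dou2026`; referee by rule; salvage by family; writer-1; sources
lit-4: `pub/ns-claims/sources/Chio2026/`, LOCATORS.md, `2603.28308v2-pages/`, TeX). UNREFEREED CLAIM under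
adjudication — NOTHING in this file asserts a step: every `Step_k` is a `Prop` (a printed assertion, typed so
that `¬ Step_k` or its vacuity is a kernel statement for `Theorems/SoloRefuteChio2026.lean`); the only
`theorem`s are the kernel composition of the paper's own implications and plumbing.

Version of record: arXiv:2603.28308 **v2** (2026-04-07, 20 pp.) [Chio2026WeakSingularity]; print page = PDF
page; TeX line numbers `l.` refer to `arxiv/2603.28308v2-2026-04-07.tex`. The mathematical core §§2–5 is
identical in v1. Companion arXiv:2603.07574 v1 [Chio2026SteadyWeakSingularity] (steady wall-bounded flows,
«ν → 0 where u·∇E = 0») is lineage, not on the path of Theorem 1.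

## Claimed statement (as printed, p. 7)

**Theorem 1** [l.217–218]: «There exists a smooth, compactly supported, divergence-free initial velocity field
u₀, such that the corresponding strong solution of the 3D NS equations forms a finite-time weak singularity at
T* < ∞, and the solution can be extended to a global Leray weak solution for all time t ≥ 0.» **Corollary 1**
[l.230–232]: «The global regularity conjecture for the 3D incompressible Navier–Stokes equations is false. …»
Setting §2 [l.59, l.71–82]: «Ω ⊂ ℝ³ a bounded Lipschitz domain», no-slip `u|_{∂Ω} = 0`, `ν > 0`, no force;
«finite-time weak singularity» = Definition 2 p. 5–6. Typed: `ClaimedTheorem`.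

## Clay delta (reference `ClayVariants.lean`, Δ-axes §3) — recorded, no Clay link is stated

Nearest: (C) breakdown on ℝ³. **Δ1 DOMAIN differs**: bounded (Lipschitz) domain with NO-SLIP WALLS — neither
ℝ³ (C) nor 𝕋³ (D); `ClayVariants` has no initial–boundary-value spec. **Δ5/Δ6 FORM OF THE NEGATION differs**: a
«finite-time weak singularity» (Def. 2: velocity bounded, `liminf_{t→T*} ‖∇u‖_{L²(U)} = 0`, `u(T*) ∉ H¹_loc`)
of the strong solution, WITH a global Leray continuation — not «no smooth finite-energy solution on
ℝ³ × [0,∞)». Δ2 = (NS, ν > 0) · Δ3 = (f ≡ 0) · Δ4 «smooth, compactly supported, div-free» — but item (1) of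
the proof builds `u₀ = (ψ(x₂),0,0) + εη` on a wall-bounded domain. Corollary 1 is the only (bare) bridge to
Clay. So NO `clay_of_claimed` lemma exists for this file; the wrong-problem note is the STATEMENT-level record
(CARD §3), the steps below locate the argument's own break.

## Rendering

Everything is typed on the printed setting: the Steps over an open (bounded where printed) `Ω ⊆ ℝ³`, the
∃-claims (Theorem 1, Step 5) INSTANTIATED at open balls `Ω = B(c,r)` (bounded Lipschitz domains — an instance
of the printed class; Mathlib has no Lipschitz-domain predicate), a CLASSICAL rendering of the strong
solution on `Ω × [0,T)` (`IsStrongSolutionOn`: smooth slices, momentum equation and incompressibility pointwise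
in `Ω`, no-slip on `frontier Ω`, initial datum; the one-sided time derivative is the tree's `timeDerivWithin`;
TODO(general form): `L^∞H¹₀ ∩ L²H²`), «Lagrangian material volume» `Ω(t)` = a family `V t ⊆ Ω` transported by
a flow map of `u` (`IsMaterialFamily`), `K(t) = ½∫_{V t}|u|²` (`kinE`), `E = ½|u|² + p` (`mechE`), `u·∇E`
(`critQ`), `|∇u|²` = the tree's `frobeniusNormSq (fderiv ℝ (u t) x)`.

## Step table (k · decl · locator · content; typist's private flags live in the CARD, nothing asserted)

* 0 · `Step_0` · §3.1 p. 4 [l.103–114] «pointwise mechanical energy transport equation»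
  `∂ₜE + u·∇E = −ν|∇u|²` — for every strong solution, at every `(x,t) ∈ Ω × [0,T)`. `EnergyTransport_pt` =
  the SAME display at the grain of its printed derivation («Taking the dot product of the NS momentum
  equation with u, and applying ∇·u = 0»): fields `u, p` satisfying the momentum equation and
  incompressibility AT ONE POINT; `step0_of_pt : EnergyTransport_pt → Step_0` PROVED.
* 1 · `Step_1` · Lemma 1 p. 4–5 [l.129–156] · `K̇(t*) > 0` ⇒ `u·∇E = 0` on a positive-measure `G ⊆ Ω(t*)` and
  a.e. in `Ω(t)` for `t ∈ [t*,T*)`.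
* 2 · `Step_2` · Lemma 2 p. 5 [l.161–166] · critical condition ⇒ `K̇ + ν∫_{Ω(t)}|∇u|² = 0`.
* 3 · `Step_3` · Lemma 3 p. 6 [l.182–196] · critical condition (with transition at `t*`) ⇒
  `‖∇u(t)‖_{L²(Ω(t))} = 0` for a.e. `t ∈ [t*,T*)` and `→ 0` as `t → T*`.
* 4 · `Step_4` · Lemma 4 p. 6 [l.199–206] · local strong well-posedness for smooth compactly supported div-free
  data (the display prints «T* < ∞» inside the solution class; typed WITHOUT that clause — not consumed).
* 5 · `Step_5` · Lemma 5 p. 6 + Theorem 1 items (1)–(2) p. 7 [l.207–222] · there is a smooth compactly supported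
  div-free datum whose strong solution has a material volume with `K̇(t*) > 0` at some `t* ∈ (0,T*)`.
* 6 · `Step_6` · Theorem 1 item (4) p. 7 [l.225] · «the L² norm of the velocity gradient tends to zero as t → T*,
  satisfying all the defining conditions of finite-time weak singularities»: `T* < ∞` and
  `‖∇u‖_{L²(Ω(t))} → 0` ⇒ a weak singularity (Def. 2) at some `x* ∈ Ω` AND a global Leray continuation (item (6)
  [l.228]).
* 7 · `Step_7` · Theorem 1 item (5) p. 7 [l.226–227] · «If T* = ∞, the velocity field must be identically zero,
  which contradicts K̇ > 0»: a GLOBAL strong solution with a transition time and the locked critical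
  condition is impossible.
* `claim_of_steps : Step_1 → Step_3 → Step_4 → Step_5 → Step_6 → Step_7 → ClaimedTheorem` PROVED (the chain
  composes GIVEN its steps; Step 0 and Step 2 enter only through the printed proofs of Steps 1–3, recorded in
  their docstrings — `Step_0` is the common input of Lemmas 1, 2, 3).

WHAT THIS IS NOT: not a claim about NS regularity or blow-up; not a claim about any author beyond the typed
locator.
-/

noncomputable section

open Set Function Filter MeasureTheory
open scoped Topology ENNReal NNReal ContDiff Laplacian InnerProductSpace

namespace Literature.Claims.NS.Chio2026

open Literature.Analysis.FluidPDE

/-! ### Vocabulary (definitions with bodies; nothing asserted) -/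

/-- `ℝ³`. [cite: Chio2026WeakSingularity, §2 p.2] -/
abbrev E3 : Type := EuclideanSpace ℝ (Fin 3)

/-- `|∇u|²(x) = Σᵢⱼ (∂ᵢuⱼ)²`, the dissipation density (§3.1 p. 4: «−ν|∇u|² represents the viscous dissipation»)
= the tree's Frobenius norm of `Du(x)`. [cite: Chio2026WeakSingularity, §3.1 p.4] -/
def gradSq (w : E3 → E3) (x : E3) : ℝ :=
  frobeniusNormSq (fderiv ℝ w x)

/-- `E = ½|u|² + p`, «the mechanical energy per unit mass» (§3.1 p. 4, l.105–108).
[cite: Chio2026WeakSingularity, §3.1 p.4] -/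
def mechE (u : ℝ → E3 → E3) (p : ℝ → E3 → ℝ) (t : ℝ) (x : E3) : ℝ :=
  (1 / 2) * ‖u t x‖ ^ 2 + p t x

/-- `u·∇E` at `(x,t)` (the «critical condition» is `u·∇E = 0`, §3 p. 4). [cite: Chio2026WeakSingularity, §3 p.4] -/
def critQ (u : ℝ → E3 → E3) (p : ℝ → E3 → ℝ) (t : ℝ) (x : E3) : ℝ :=
  fderiv ℝ (mechE u p t) x (u t x)

/-- A CLASSICAL rendering of «strong solution of the 3D NS equations with no-slip boundary conditions» on
`Ω × S` (§2.2 p. 3, l.71–82; Lemma 4 p. 6): smooth slices on `ℝ³`, momentum equation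
`∂ₜu + (u·∇)u = −∇p + νΔu` and `∇·u = 0` pointwise in `Ω` for `t ∈ S` (one-sided time derivative within `S`),
time-differentiability at the points used, no-slip `u = 0` on `∂Ω`, datum `u(0) = u₀` on `Ω`.
TODO(general form): `u ∈ L^∞(0,T;H¹₀) ∩ L²(0,T;H²)`. [cite: Chio2026WeakSingularity, §2.2 p.3; Lemma 4 p.6] -/
structure IsStrongSolutionOn (Ω : Set E3) (S : Set ℝ) (ν : ℝ) (u₀ : E3 → E3) (u : ℝ → E3 → E3)
    (p : ℝ → E3 → ℝ) : Prop where
  /-- smooth velocity slices -/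
  smooth_u : ∀ t ∈ S, ContDiff ℝ ∞ (u t)
  /-- smooth pressure slices -/
  smooth_p : ∀ t ∈ S, ContDiff ℝ ∞ (p t)
  /-- velocity and pressure are time-differentiable within `S` at every point of `Ω` -/
  timeDiff : ∀ t ∈ S, ∀ x ∈ Ω, DifferentiableWithinAt ℝ (fun s => u s x) S t ∧
    DifferentiableWithinAt ℝ (fun s => p s x) S t
  /-- momentum equation in `Ω` -/
  momentum : ∀ t ∈ S, ∀ x ∈ Ω,
    timeDerivWithin S u t x + convect (u t) (u t) x = -gradient (p t) x + ν • Δ (u t) x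
  /-- incompressibility in `Ω` -/
  divFree : ∀ t ∈ S, ∀ x ∈ Ω, VectorCalculus.divergence (u t) x = 0
  /-- no-slip -/
  noSlip : ∀ t ∈ S, ∀ x ∈ frontier Ω, u t x = 0
  /-- initial datum -/
  initial : ∀ x ∈ Ω, u 0 x = u₀ x

/-- «Let Ω(t) be a Lagrangian material volume moving with the fluid flow» (§3.2 p. 4, l.115–118): the family
`V t ⊆ Ω` is the image of `V 0` under a flow map `X` of `u` on the time set `S`.
[cite: Chio2026WeakSingularity, §3.2 p.4] -/
def IsMaterialFamily (Ω : Set E3) (S : Set ℝ) (u : ℝ → E3 → E3) (V : ℝ → Set E3) : Prop :=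
  (∀ t ∈ S, V t ⊆ Ω ∧ MeasurableSet (V t)) ∧
    ∃ X : ℝ → E3 → E3, (∀ a, X 0 a = a) ∧
      (∀ a ∈ V 0, ∀ t ∈ S, HasDerivWithinAt (fun s => X s a) (u t (X t a)) S t) ∧
      ∀ t ∈ S, V t = X t '' V 0

/-- `K(t) = ½∫_{Ω(t)}|u|² dx`, «the local total kinetic energy within this volume» (§3.2 p. 4, l.117–119).
[cite: Chio2026WeakSingularity, §3.2 p.4] -/
def kinE (V : ℝ → Set E3) (u : ℝ → E3 → E3) (t : ℝ) : ℝ :=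
  ∫ x in V t, (1 / 2) * ‖u t x‖ ^ 2

/-- `K̇(t)` within the time set `S`. [cite: Chio2026WeakSingularity, §3.2 p.4] -/
def kinERate (S : Set ℝ) (V : ℝ → Set E3) (u : ℝ → E3 → E3) (t : ℝ) : ℝ :=
  derivWithin (kinE V u) S t

/-- `‖∇u(t)‖²_{L²(Ω(t))}` (Lemma 2, Lemma 3 p. 5–6). [cite: Chio2026WeakSingularity, Lemma 3 p.6] -/
def gradL2Sq (V : ℝ → Set E3) (u : ℝ → E3 → E3) (t : ℝ) : ℝ :=
  ∫ x in V t, gradSq (u t) x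

/-- «the critical condition u·∇E = 0 holds almost everywhere in Ω(t)» for `t ∈ [t*,T)` (Lemma 1's
conclusion, the hypothesis of Lemmas 2–3). [cite: Chio2026WeakSingularity, Lemma 1 p.4] -/
def CritLocked (V : ℝ → Set E3) (u : ℝ → E3 → E3) (p : ℝ → E3 → ℝ) (tstar T : ℝ) : Prop :=
  ∀ t ∈ Ico tstar T, ∀ᵐ x : E3, x ∈ V t → critQ u p t x = 0

/-- «smooth, compactly supported, divergence-free initial velocity field» IN `Ω` (Theorem 1 p. 7; Lemma 5
p. 6: `η ∈ C_c^∞(Ω)`). [cite: Chio2026WeakSingularity, Theorem 1 p.7] -/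
def IsDatum (Ω : Set E3) (u₀ : E3 → E3) : Prop :=
  ContDiff ℝ ∞ u₀ ∧ HasCompactSupport u₀ ∧ tsupport u₀ ⊆ Ω ∧ VectorCalculus.IsDivFree u₀

/-- The Leray class of Definition 1 (p. 3, l.83–100), rendered by its third clause (the global energy
inequality) and agreement with the datum — the part of «can be extended to a global Leray weak solution» that
the print uses (item (6) p. 7: «maintains the L^∞L² ∩ L²H¹₀ boundedness required by Leray weak solutions»).
TODO(general form): the variational identity of Definition 1 (2). [cite: Chio2026WeakSingularity, Def. 1 p.3; Thm 1 item (6) p.7] -/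
def InLerayEnergyClass (Ω : Set E3) (ν : ℝ) (u₀ : E3 → E3) (v : ℝ → E3 → E3) : Prop :=
  (∀ x ∈ Ω, v 0 x = u₀ x) ∧
    ∀ t, 0 ≤ t →
      (1 / 2) * ∫ x in Ω, ‖v t x‖ ^ 2 + ν * ∫ τ in (0:ℝ)..t, ∫ x in Ω, gradSq (v τ) x ≤
        (1 / 2) * ∫ x in Ω, ‖u₀ x‖ ^ 2

/-- **Definition 2 (finite-time weak singularity at `(T*, x*)`)** (p. 5–6, l.170–178), for the strong solution
`u` on `[0,T*)` and its continuation `v` (whose time-`T*` slice is «u(T*)»): (1) for `t < T*`, `u(t)` is `H¹`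
near `x*` (rendered: `|∇u(t)|²` integrable on a neighbourhood); (2) `liminf_{t→T*} ‖∇u‖_{L²(U)} = 0` for
every neighbourhood `U` of `x*`; (3) `u(T*) ∉ H¹_loc(x*)` (rendered: on no neighbourhood of `x*` is `v(T*)` a
`C¹` field with square-integrable gradient). «this weak singularity is a non-blowup singularity, meaning the
velocity field itself remains bounded» (recorded as clause (4)). [cite: Chio2026WeakSingularity, Def. 2 p.5–6] -/
def IsWeakSingularity (u v : ℝ → E3 → E3) (T : ℝ) (xs : E3) : Prop :=
  (∀ t ∈ Ico 0 T, ∃ U ∈ 𝓝 xs, IntegrableOn (gradSq (u t)) U) ∧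
  (∀ U ∈ 𝓝 xs, Filter.liminf (fun t => ∫ x in U, gradSq (u t) x) (𝓝[<] T) = 0) ∧
  (∀ U ∈ 𝓝 xs, ¬ (ContDiffOn ℝ 1 (v T) U ∧ IntegrableOn (gradSq (v T)) U)) ∧
  ∃ M : ℝ, ∀ t ∈ Ico 0 T, ∀ x, ‖u t x‖ ≤ M

/-- `T` is the MAXIMAL existence time of the strong solution `u` from `u₀` («T* the maximal existence time of
the strong solution», Def. 2 p. 5; Lemma 4 p. 6): no strong solution from `u₀` on a longer `[0,T')` agrees with
`u` on `Ω × [0,T)`. [cite: Chio2026WeakSingularity, Def. 2 p.5; Lemma 4 p.6] -/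
def IsMaximal (Ω : Set E3) (ν T : ℝ) (u₀ : E3 → E3) (u : ℝ → E3 → E3) : Prop :=
  ¬ ∃ (T' : ℝ) (u' : ℝ → E3 → E3) (p' : ℝ → E3 → ℝ), T < T' ∧
    IsStrongSolutionOn Ω (Ico 0 T') ν u₀ u' p' ∧ ∀ t ∈ Ico 0 T, ∀ x ∈ Ω, u' t x = u t x

/-! ### The claimed theorem (p. 7) -/

/-- **Theorem 1 (p. 7), as printed**, on the printed setting («Ω ⊂ ℝ³ a bounded Lipschitz domain» — INSTANTIATED at open balls
`Ω = B(c,r)`, which are bounded Lipschitz domains, so the typed claim is an instance of the printed one; no-slip;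
the paper's `ν > 0` is arbitrary: for EVERY `ν > 0` and every ball, as items (1)–(6) claim for «any stable
laminar flow»): there are a smooth compactly supported
divergence-free datum `u₀`, a strong solution `(u,p)` on `Ω × [0,T*)` with `T* < ∞`, a point `x* ∈ Ω` and a
continuation `v` in the Leray energy class agreeing with `u` before `T*`, such that `(T*, x*)` is a
finite-time weak singularity. [claim: Chio2026WeakSingularity, status: disputed] -/
def ClaimedTheorem : Prop :=
  ∀ ν : ℝ, 0 < ν → ∀ (c : E3) (r : ℝ), 0 < r →
    ∃ (u₀ : E3 → E3) (T : ℝ) (u : ℝ → E3 → E3) (p : ℝ → E3 → ℝ) (v : ℝ → E3 → E3) (xs : E3),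
      IsDatum (Metric.ball c r) u₀ ∧ 0 < T ∧ IsStrongSolutionOn (Metric.ball c r) (Ico 0 T) ν u₀ u p ∧
      IsMaximal (Metric.ball c r) ν T u₀ u ∧ xs ∈ Metric.ball c r ∧ (∀ t ∈ Ico 0 T, ∀ x ∈ Metric.ball c r, v t x = u t x) ∧
      InLerayEnergyClass (Metric.ball c r) ν u₀ v ∧ IsWeakSingularity u v T xs

/-! ### The paper's steps (no assertion) -/

/-- **Step 0 at the grain of its printed derivation — `EnergyTransport_pt`** (§3.1 p. 4, l.109–114): «Taking
the dot product of the NS momentum equation with the velocity field u, and applying the incompressibility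
condition ∇·u = 0 to simplify the nonlinear convective term and pressure gradient term, we derive the
pointwise mechanical energy transport equation ∂ₜE + u·∇E = −ν|∇u|².» Typed for smooth fields `u, p` on a
time set `S` and ONE point `(t,x)` at which the momentum equation and `∇·u = 0` hold (nothing else is used by
the printed derivation): the display holds at `(t,x)`, with `∂ₜ` the one-sided derivative within `S`.
[claim: Chio2026WeakSingularity, status: disputed] -/
def EnergyTransport_pt : Prop :=
  ∀ ν : ℝ, 0 < ν → ∀ (S : Set ℝ) (u : ℝ → E3 → E3) (p : ℝ → E3 → ℝ) (t : ℝ) (x : E3), t ∈ S →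
    ContDiff ℝ ∞ (u t) → ContDiff ℝ ∞ (p t) →
    DifferentiableWithinAt ℝ (fun s => u s x) S t → DifferentiableWithinAt ℝ (fun s => p s x) S t →
    timeDerivWithin S u t x + convect (u t) (u t) x = -gradient (p t) x + ν • Δ (u t) x →
    VectorCalculus.divergence (u t) x = 0 →
    timeDerivWithin S (mechE u p) t x + critQ u p t x = -ν * gradSq (u t) x

/-- **Step 0 — the «pointwise mechanical energy transport equation» (§3.1 p. 4, l.103–114)
`∂ₜE + u·∇E = −ν|∇u|²`, `E = ½|u|² + p`**, for every strong solution on the printed setting, at every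
`(x,t) ∈ Ω × [0,T)`. It is the input of the proofs of Lemma 1 (Reynolds transport of `∫_{Ω(t)}E`), Lemma 2 and
Lemma 3. [claim: Chio2026WeakSingularity, status: disputed] -/
def Step_0 : Prop :=
  ∀ ν : ℝ, 0 < ν → ∀ (Ω : Set E3), IsOpen Ω → ∀ T : ℝ, 0 < T →
    ∀ (u₀ : E3 → E3) (u : ℝ → E3 → E3) (p : ℝ → E3 → ℝ), IsStrongSolutionOn Ω (Ico 0 T) ν u₀ u p →
    ∀ t ∈ Ico 0 T, ∀ x ∈ Ω,
      timeDerivWithin (Ico 0 T) (mechE u p) t x + critQ u p t x = -ν * gradSq (u t) x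

/-- **Step 1 — Lemma 1 (p. 4, l.129–131)**: «If laminar-turbulent transition occurs at the critical time t*,
i.e., K̇(t*) > 0, then there exists a positive-measure set G ⊂ Ω(t*) such that u·∇E(t*,x) = 0 for all x ∈ G.
Furthermore, for all subsequent time t ∈ [t*,T*), the condition u·∇E = 0 holds almost everywhere in Ω(t).»
(Printed proof: Step 0 + Reynolds transport; «the integral of u·∇E over Ω(t*) must be zero»; Lebesgue
density; `Φ(t) = ∫|u·∇E|²`, `DΦ/Dt ≤ C(t)Φ`, Gronwall from `Φ(t*) = 0`.) [claim: Chio2026WeakSingularity, status: disputed] -/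
def Step_1 : Prop :=
  ∀ ν : ℝ, 0 < ν → ∀ (Ω : Set E3), IsOpen Ω → ∀ T : ℝ, 0 < T →
    ∀ (u₀ : E3 → E3) (u : ℝ → E3 → E3) (p : ℝ → E3 → ℝ), IsStrongSolutionOn Ω (Ico 0 T) ν u₀ u p →
    ∀ V : ℝ → Set E3, IsMaterialFamily Ω (Ico 0 T) u V →
    ∀ tstar ∈ Ico 0 T, 0 < kinERate (Ico 0 T) V u tstar →
      (∃ G ⊆ V tstar, 0 < volume G ∧ ∀ x ∈ G, critQ u p tstar x = 0) ∧ CritLocked V u p tstar T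

/-- **Step 2 — Lemma 2 (p. 5, l.161–166)**: «Under the critical condition u·∇E = 0 (almost everywhere), the
kinetic energy evolution equation simplifies to a strict energy identity:
d/dt ∫_{Ω(t)} ½|u|² dx + ν∫_{Ω(t)}|∇u|² dx = 0.» [claim: Chio2026WeakSingularity, status: disputed] -/
def Step_2 : Prop :=
  ∀ ν : ℝ, 0 < ν → ∀ (Ω : Set E3), IsOpen Ω → ∀ T : ℝ, 0 < T →
    ∀ (u₀ : E3 → E3) (u : ℝ → E3 → E3) (p : ℝ → E3 → ℝ), IsStrongSolutionOn Ω (Ico 0 T) ν u₀ u p →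
    ∀ V : ℝ → Set E3, IsMaterialFamily Ω (Ico 0 T) u V → ∀ tstar ∈ Ico 0 T, CritLocked V u p tstar T →
      ∀ t ∈ Ico tstar T, kinERate (Ico 0 T) V u t + ν * gradL2Sq V u t = 0

/-- **Step 3 — Lemma 3 (p. 6, l.182–196)**: «Under the critical condition u·∇E = 0, the L² norm of the velocity
gradient satisfies ‖∇u(t)‖_{L²(Ω(t))} = 0 a.e. t ∈ [t*,T*), and … lim_{t→T*}‖∇u‖_{L²(Ω(t))} = 0.» (Printed
proof: «From Lemma 2, K̇ = −ν‖∇u‖². During the transition process, K̇ ≥ 0 …, while the right-hand side ≤ 0. The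
only way to satisfy this equality is that both terms vanish almost everywhere.») Typed with the transition
hypothesis `K̇(t*) > 0` of Lemma 1 in force. [claim: Chio2026WeakSingularity, status: disputed] -/
def Step_3 : Prop :=
  ∀ ν : ℝ, 0 < ν → ∀ (Ω : Set E3), IsOpen Ω → ∀ T : ℝ, 0 < T →
    ∀ (u₀ : E3 → E3) (u : ℝ → E3 → E3) (p : ℝ → E3 → ℝ), IsStrongSolutionOn Ω (Ico 0 T) ν u₀ u p →
    ∀ V : ℝ → Set E3, IsMaterialFamily Ω (Ico 0 T) u V →
    ∀ tstar ∈ Ico 0 T, 0 < kinERate (Ico 0 T) V u tstar → CritLocked V u p tstar T →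
      (∀ᵐ t : ℝ, t ∈ Ico tstar T → gradL2Sq V u t = 0) ∧
        Tendsto (gradL2Sq V u) (𝓝[<] T) (𝓝 0)

/-- **Step 4 — Lemma 4 (p. 6, l.199–206), local well-posedness**: «For any initial velocity field u₀ ∈ H¹₀ with
∇·u₀ = 0, there exists a unique local strong solution of the 3D NS equations on the time interval [0,T*), such
that u ∈ L^∞(0,T;H¹₀) ∩ L²(0,T;H²), T* < ∞» — typed for the data class of Theorem 1 as: a strong solution
exists on some `[0,T)`, and it is either global or has a finite maximal time (the printed «T* < ∞» INSIDE the
class display is not consumed by the chain: item (5) argues finiteness separately). Classical.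
[cite: Chio2026WeakSingularity, Lemma 4 p.6] -/
def Step_4 : Prop :=
  ∀ ν : ℝ, 0 < ν → ∀ (Ω : Set E3), IsOpen Ω → Bornology.IsBounded Ω →
    ∀ u₀ : E3 → E3, IsDatum Ω u₀ →
      (∃ (u : ℝ → E3 → E3) (p : ℝ → E3 → ℝ), IsStrongSolutionOn Ω (Ici 0) ν u₀ u p) ∨
      ∃ (T : ℝ) (u : ℝ → E3 → E3) (p : ℝ → E3 → ℝ), 0 < T ∧ IsStrongSolutionOn Ω (Ico 0 T) ν u₀ u p ∧
        IsMaximal Ω ν T u₀ u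

/-- **Step 5 — Lemma 5 (p. 6, l.207–214) with Theorem 1 items (1)–(2) (p. 7, l.219–222)**: «For any stable
laminar flow u_lam, there exists a smooth, compactly supported, divergence-free perturbation η ∈ C_c^∞(Ω) such
that u₀ = u_lam + εη is linearly unstable»; (1) `u_lam = (ψ(x₂),0,0)`, `η = ∇ × (ζ(x₁,x₂)φ(x₃)e₃)`,
«ensuring the initial field is smooth, compactly supported, and divergence-free»; (2) «The perturbed initial
field possesses a growing linear mode with Re λ > 0, leading to the increase of local kinetic energy K̇(t) > 0,
triggering the laminar-turbulent transition». Typed as what the chain consumes: on every ball `Ω = B(c,r)`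
there is a datum of the class such that EVERY strong solution from it (local or global) carries a material
volume with `K̇(t*) > 0` at some `t* ∈ (0,T)`. [claim: Chio2026WeakSingularity, status: disputed] -/
def Step_5 : Prop :=
  ∀ ν : ℝ, 0 < ν → ∀ (c : E3) (r : ℝ), 0 < r →
    ∃ u₀ : E3 → E3, IsDatum (Metric.ball c r) u₀ ∧
      ∀ (S : Set ℝ) (u : ℝ → E3 → E3) (p : ℝ → E3 → ℝ), (S = Ici 0 ∨ ∃ T, 0 < T ∧ S = Ico 0 T) →
        IsStrongSolutionOn (Metric.ball c r) S ν u₀ u p →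
        ∃ V : ℝ → Set E3, IsMaterialFamily (Metric.ball c r) S u V ∧
          ∃ tstar ∈ S, 0 < tstar ∧ 0 < kinERate S V u tstar

/-- **Step 6 — Theorem 1 items (4) and (6) (p. 7, l.225, l.228)**: «(4) H¹₀ regularity collapse: According to
Lemma 3, the L² norm of the velocity gradient tends to zero as t → T*, satisfying all the defining conditions of
finite-time weak singularities»; «(6) Compatibility with Leray theory: … the solution can be extended globally
as a Leray weak solution». Typed as the implication the items assert: a strong solution on `[0,T)`, `T < ∞`
maximal, with `‖∇u‖_{L²(Ω(t))} → 0` along a material volume, has a weak singularity (Def. 2) at some `x* ∈ Ω`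
and a continuation in the Leray energy class. [claim: Chio2026WeakSingularity, status: disputed] -/
def Step_6 : Prop :=
  ∀ ν : ℝ, 0 < ν → ∀ (Ω : Set E3), IsOpen Ω → ∀ T : ℝ, 0 < T →
    ∀ (u₀ : E3 → E3) (u : ℝ → E3 → E3) (p : ℝ → E3 → ℝ), IsStrongSolutionOn Ω (Ico 0 T) ν u₀ u p →
    IsMaximal Ω ν T u₀ u →
    ∀ V : ℝ → Set E3, IsMaterialFamily Ω (Ico 0 T) u V → Tendsto (gradL2Sq V u) (𝓝[<] T) (𝓝 0) →
      ∃ (v : ℝ → E3 → E3) (xs : E3), xs ∈ Ω ∧ (∀ t ∈ Ico 0 T, ∀ x ∈ Ω, v t x = u t x) ∧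
        InLerayEnergyClass Ω ν u₀ v ∧ IsWeakSingularity u v T xs

/-- **Step 7 — Theorem 1 item (5) (p. 7, l.226–227)**: «Finiteness of maximal existence time: If T* = ∞, the
velocity field must be identically zero, which contradicts the positive kinetic energy growth K̇ > 0 during
transition, thus T* < ∞.» Typed: a GLOBAL strong solution carrying a material volume with a transition time
`t*` (`K̇(t*) > 0`) at which the critical condition is locked (Lemma 1) is impossible.
[claim: Chio2026WeakSingularity, status: disputed] -/
def Step_7 : Prop :=
  ∀ ν : ℝ, 0 < ν → ∀ (Ω : Set E3), IsOpen Ω →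
    ∀ (u₀ : E3 → E3) (u : ℝ → E3 → E3) (p : ℝ → E3 → ℝ), IsStrongSolutionOn Ω (Ici 0) ν u₀ u p →
    ∀ V : ℝ → Set E3, IsMaterialFamily Ω (Ici 0) u V →
    ∀ tstar, 0 < tstar → 0 < kinERate (Ici 0) V u tstar →
      (∀ t, tstar ≤ t → ∀ᵐ x : E3, x ∈ V t → critQ u p t x = 0) → False

/-- **Step 1 on the global time set** (Lemma 1 is stated for `t ∈ [t*,T*)` with `T*` the maximal time,
`T* = ∞` allowed): the same assertion for a global strong solution. [claim: Chio2026WeakSingularity, status: disputed] -/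
def Step_1_global : Prop :=
  ∀ ν : ℝ, 0 < ν → ∀ (Ω : Set E3), IsOpen Ω →
    ∀ (u₀ : E3 → E3) (u : ℝ → E3 → E3) (p : ℝ → E3 → ℝ), IsStrongSolutionOn Ω (Ici 0) ν u₀ u p →
    ∀ V : ℝ → Set E3, IsMaterialFamily Ω (Ici 0) u V →
    ∀ tstar, 0 ≤ tstar → 0 < kinERate (Ici 0) V u tstar →
      ∀ t, tstar ≤ t → ∀ᵐ x : E3, x ∈ V t → critQ u p t x = 0

/-! ### Kernel compositions (the paper's own implications; PROVED) -/

/-- **Step 0 from its printed derivation grain**: a strong solution satisfies, at each `(x,t) ∈ Ω × [0,T)`, the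
hypotheses of `EnergyTransport_pt`. [cite: Chio2026WeakSingularity, §3.1 p.4] -/
theorem step0_of_pt (h : EnergyTransport_pt) : Step_0 := by
  intro ν hν Ω _hΩ T _hT u₀ u p hsol t ht x hx
  exact h ν hν (Ico 0 T) u p t x ht (hsol.smooth_u t ht) (hsol.smooth_p t ht) (hsol.timeDiff t ht x hx).1
    (hsol.timeDiff t ht x hx).2 (hsol.momentum t ht x hx) (hsol.divFree t ht x hx)

/-- **Theorem 1 from the paper's steps** (p. 7): Step 5 supplies the datum with a transition time for every
strong solution from it; Step 4 supplies a maximal strong solution; if it were global, Lemma 1 (global form)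
locks the critical condition and item (5) (Step 7) is contradicted, so `T* < ∞`; then Lemma 1 + Lemma 3 give
`‖∇u‖_{L²(Ω(t))} → 0`, and items (4),(6) (Step 6) give the weak singularity with its Leray continuation.
[cite: Chio2026WeakSingularity, proof of Theorem 1 p.7] -/
theorem claim_of_steps (h1 : Step_1) (h1g : Step_1_global) (h3 : Step_3) (h4 : Step_4) (h5 : Step_5)
    (h6 : Step_6) (h7 : Step_7) : ClaimedTheorem := by
  intro ν hν c r hr
  have hΩ : IsOpen (Metric.ball c r) := Metric.isOpen_ball
  have hΩb : Bornology.IsBounded (Metric.ball c r) := Metric.isBounded_ball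
  obtain ⟨u₀, hu₀, hK⟩ := h5 ν hν c r hr
  rcases h4 ν hν _ hΩ hΩb u₀ hu₀ with ⟨u, p, hglob⟩ | ⟨T, u, p, hT, hsol, hmax⟩
  · -- a global strong solution is excluded by item (5)
    exfalso
    obtain ⟨V, hV, tstar, htstar, htpos, hrate⟩ := hK (Ici 0) u p (Or.inl rfl) hglob
    exact h7 ν hν _ hΩ u₀ u p hglob V hV tstar htpos hrate
      (h1g ν hν _ hΩ u₀ u p hglob V hV tstar htstar hrate)
  · obtain ⟨V, hV, tstar, htstar, _htpos, hrate⟩ := hK (Ico 0 T) u p (Or.inr ⟨T, hT, rfl⟩) hsol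
    have hlock : CritLocked V u p tstar T := (h1 ν hν _ hΩ T hT u₀ u p hsol V hV tstar htstar hrate).2
    have hlim : Tendsto (gradL2Sq V u) (𝓝[<] T) (𝓝 0) :=
      (h3 ν hν _ hΩ T hT u₀ u p hsol V hV tstar htstar hrate hlock).2
    obtain ⟨v, xs, hxs, hagree, hLeray, hsing⟩ := h6 ν hν _ hΩ T hT u₀ u p hsol hmax V hV hlim
    exact ⟨u₀, T, u, p, v, xs, hu₀, hT, hsol, hmax, hxs, hagree, hLeray, hsing⟩

end Literature.Claims.NS.Chio2026

end
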